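import Literature.NumberTheory.ModularForms.DombEtaQuotientCMValues
import Literature.NumberTheory.EllipticCurves.EtaQuotientQExpansionProofs
import HarnessLib

/-!
# `t(τ₀) = −1/64` and `Z(τ₀) > 0`: the signs of the level-6 `η`-quotients on the line `Re τ = −1/2`

Sibling of `DombEtaQuotientCMValues.lean` (which computes the MODULI `|t(τ₀)| = 1/64`,
`|Z(τ₀)|² = 4G/(75π²)` at `τ₀ = −1/2 + i√15/6`). Here the signs are settled, giving the exact
statement of [BorweinEtAl2012, §4 Remark 7] that the argument `x(τ) = 8i(η(2τ)η(6τ)/(η(τ)η(3τ)))³`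
of the modular parametrisation of `p₄` has `x(τ₀)² = −64 t(τ₀) = 1`:

* on the vertical line `τ = −1/2 + iy` the nome `q = e^{2πiτ} = −e^{−2πy}` is REAL, so every
  Euler function `∏ (1 − q^{δn})` is real (it is invariant under complex conjugation, which fixes
  `q`; `conj_eulerFn_halfLinePt`), non-zero, tends to `1` as `y → ∞`, hence is POSITIVE along the whole
  line (intermediate value theorem; `eulerUnit_re_pos`);
* an `η`-quotient factors as `e^{2πiτ Σδr_δ/24} · ∏_δ (∏_n (1 − q^{δn}))^{r_δ}`
  (`etaQuotient_eq_cexp_mul_prod_eulerFn`); for `t` (`Σ δ r_δ = 24`) the prefactor is `q < 0`, for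
  `Z` (`Σ δ r_δ = 0`) it is `1`;
* hence **`t(τ₀) = −1/64`** (`dombHauptmodul_bswzPoint`) and **`Z(τ₀) = 2√(G/75)/π > 0`**
  (`dombModularForm_bswzPoint`), `G = Γ(1/15)Γ(2/15)Γ(4/15)Γ(8/15)/(Γ(7/15)Γ(11/15)Γ(13/15)Γ(14/15))`.

## References

* [BorweinEtAl2012] J. M. Borwein, A. Straub, J. Wan, W. Zudilin, *Densities of short uniform random
  walks*, Canad. J. Math. 64 (2012), §4 Remark 7, §5 Thm. 9.
-/

noncomputable section

open UpperHalfPlane hiding I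
open Complex Filter Topology Finset
open scoped Real MatrixGroups ModularForm ComplexConjugate

open Literature.NumberTheory.EllipticCurves.ModularForms
open Literature.NumberTheory.QuadraticFields.KroneckerLimit (rootPoint)

namespace Literature.NumberTheory.ModularForms

/-! ### The line `Re τ = −1/2` -/

/-- The point `−1/2 + iy` of the upper half plane (`y > 0`). [folklore] -/
def halfLinePt (y : ℝ) (hy : 0 < y) : ℍ :=
  ⟨-1 / 2 + y * I, by simpa using hy⟩

/-- The underlying complex number. [folklore] -/
theorem coe_halfLinePt (y : ℝ) (hy : 0 < y) : ((halfLinePt y hy : ℍ) : ℂ) = -1 / 2 + y * I := rfl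

/-- `τ₀ = halfLinePt (√15/6)`. [folklore] -/
theorem bswzPoint_eq_halfLinePt : bswzPoint = halfLinePt (Real.sqrt 15 / 6) (by positivity) := by
  apply UpperHalfPlane.ext
  rw [coe_bswzPoint, coe_halfLinePt]
  push_cast
  ring

/-- **The nome is real and negative on the line**: `q(−1/2 + iy) = −e^{−2πy}`. [folklore] -/
theorem qParam_one_halfLinePt (y : ℝ) (hy : 0 < y) :
    Function.Periodic.qParam 1 ((halfLinePt y hy : ℍ) : ℂ) = -(Real.exp (-2 * π * y) : ℝ) := by
  rw [Function.Periodic.qParam, coe_halfLinePt, Complex.ofReal_one, div_one]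
  rw [show 2 * π * I * (-1 / 2 + y * I) = (-2 * π * y : ℂ) + (-π : ℂ) * I by
    ring_nf; rw [Complex.I_sq]; ring]
  rw [Complex.exp_add, show (-π : ℂ) * I = -(π * I) by ring, Complex.exp_neg, Complex.exp_pi_mul_I]
  push_cast
  ring

/-- Complex conjugation fixes the nome on the line. [folklore] -/
theorem conj_qParam_one_halfLinePt (y : ℝ) (hy : 0 < y) :
    conj (Function.Periodic.qParam 1 ((halfLinePt y hy : ℍ) : ℂ)) =
      Function.Periodic.qParam 1 ((halfLinePt y hy : ℍ) : ℂ) := by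
  rw [qParam_one_halfLinePt, map_neg, Complex.conj_ofReal]

/-- **The Euler functions are real on the line**: `conj ∏(1 − q^{δn}) = ∏(1 − q^{δn})` at
`τ = −1/2 + iy`. [folklore] -/
theorem conj_eulerFn_halfLinePt (δ : ℕ) (y : ℝ) (hy : 0 < y) :
    conj (eulerFn δ (halfLinePt y hy)) = eulerFn δ (halfLinePt y hy) := by
  unfold eulerFn
  rw [Function.LeftInverse.map_tprod _ (g := starRingEnd ℂ) Complex.continuous_conj
    Complex.continuous_conj (fun z => Complex.conj_conj z)]
  refine tprod_congr fun n => ?_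
  rw [map_sub, map_one, map_pow, map_pow, conj_qParam_one_halfLinePt]

/-- The imaginary part of the Euler functions vanishes on the line. [folklore] -/
theorem eulerFn_halfLinePt_im (δ : ℕ) (y : ℝ) (hy : 0 < y) : (eulerFn δ (halfLinePt y hy)).im = 0 :=
  Complex.conj_eq_iff_im.mp (conj_eulerFn_halfLinePt δ y hy)

/-! ### The Euler part of an `η`-quotient and its sign on the line -/

/-- The "Euler part" `∏_{δ ∣ N} (∏_n (1 − q^{δn}))^{r_δ}` of an `η`-quotient. [folklore] -/
def eulerUnit (N : ℕ) (r : ℕ → ℤ) (τ : ℍ) : ℂ := ∏ δ ∈ N.divisors, eulerFn δ τ ^ r δ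

/-- **`∏ η(δτ)^{r_δ} = e^{2πiτ Σδr_δ/24} · ∏ (∏(1 − q^{δn}))^{r_δ}`.** [folklore] -/
theorem etaQuotient_eq_cexp_mul_eulerUnit (N : ℕ) (r : ℕ → ℤ) (τ : ℍ) :
    etaQuotient N r τ =
      cexp (2 * π * I * τ / 24 * ((∑ δ ∈ N.divisors, (δ : ℤ) * r δ : ℤ) : ℂ)) * eulerUnit N r τ := by
  rw [etaQuotient_apply, eulerUnit]
  simp_rw [eta_natMul_eq_qParam_mul_eulerFn, mul_zpow, Finset.prod_mul_distrib]
  have hq : ∀ δ : ℕ, Function.Periodic.qParam 24 ((δ : ℂ) * τ) ^ (r δ) =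
      cexp (2 * π * I * τ / 24 * (((δ : ℤ) * r δ : ℤ) : ℂ)) := fun δ ↦ by
    rw [Function.Periodic.qParam, ← Complex.exp_int_mul]
    congr 1
    push_cast
    ring
  simp_rw [hq]
  rw [← Complex.exp_sum, ← Finset.mul_sum, ← Int.cast_sum]

/-- The Euler part has an integral unit `q`-expansion (so tends to `1` at `i∞`) and never vanishes.
[folklore] -/
theorem isIntUnitQExp_eulerUnit (N : ℕ) (r : ℕ → ℤ) : IsIntUnitQExp (eulerUnit N r) := by
  have heq : eulerUnit N r = ∏ δ ∈ N.divisors, fun τ ↦ eulerFn δ τ ^ r δ := by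
    funext τ
    rw [eulerUnit, Finset.prod_apply]
  rw [heq]
  exact IsIntUnitQExp.prod _ fun δ hδ ↦ (isIntUnitQExp_eulerFn (Nat.pos_of_mem_divisors hδ)).zpow
    (eulerFn_ne_zero (Nat.pos_of_mem_divisors hδ)) (r δ)

/-- `eulerUnit N r τ ≠ 0`. [folklore] -/
theorem eulerUnit_ne_zero (N : ℕ) (r : ℕ → ℤ) (τ : ℍ) : eulerUnit N r τ ≠ 0 :=
  Finset.prod_ne_zero_iff.mpr fun _ hδ =>
    zpow_ne_zero _ (eulerFn_ne_zero (Nat.pos_of_mem_divisors hδ) τ)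

/-- The Euler part is real on the line. [folklore] -/
theorem eulerUnit_halfLinePt_im (N : ℕ) (r : ℕ → ℤ) (y : ℝ) (hy : 0 < y) :
    (eulerUnit N r (halfLinePt y hy)).im = 0 := by
  apply Complex.conj_eq_iff_im.mp
  rw [eulerUnit, map_prod]
  refine Finset.prod_congr rfl fun δ _ => ?_
  rw [map_zpow₀, conj_eulerFn_halfLinePt]

/-- The line runs into the cusp: `−1/2 + i e^s → i∞` as `s → ∞` (parametrising `y = e^s`).
[folklore] -/
theorem tendsto_halfLinePt_exp_atImInfty :
    Tendsto (fun s : ℝ => halfLinePt (Real.exp s) (Real.exp_pos s)) atTop atImInfty := by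
  rw [UpperHalfPlane.atImInfty, tendsto_comap_iff]
  have : (UpperHalfPlane.im ∘ fun s : ℝ => halfLinePt (Real.exp s) (Real.exp_pos s)) = Real.exp := by
    funext s
    simp [Function.comp_apply, UpperHalfPlane.im, coe_halfLinePt, -Complex.ofReal_exp]
  rw [this]
  exact Real.tendsto_exp_atTop

/-- Continuity of the Euler part along the line (parametrised by `y = e^s`). [folklore] -/
theorem continuous_eulerUnit_halfLinePt_exp (N : ℕ) (r : ℕ → ℤ) :
    Continuous fun s : ℝ => eulerUnit N r (halfLinePt (Real.exp s) (Real.exp_pos s)) := by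
  have hc : Continuous (eulerUnit N r) := (isIntUnitQExp_eulerUnit N r).mdiff.continuous
  refine hc.comp ?_
  refine Continuous.upperHalfPlaneMk ?_ _
  fun_prop

/-- **The Euler part is positive on the line `Re τ = −1/2`**: it is real, non-vanishing, continuous
in `y` and tends to `1` as `y → ∞`, so the intermediate value theorem forbids a negative value.
[folklore] -/
theorem eulerUnit_re_pos (N : ℕ) (r : ℕ → ℤ) (y : ℝ) (hy : 0 < y) :
    0 < (eulerUnit N r (halfLinePt y hy)).re := by
  -- parametrise the line by `y = e^s`
  set U : ℝ → ℝ := fun s => (eulerUnit N r (halfLinePt (Real.exp s) (Real.exp_pos s))).re with hU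
  have hUc : Continuous U := Complex.continuous_re.comp (continuous_eulerUnit_halfLinePt_exp N r)
  have hUne : ∀ s : ℝ, U s ≠ 0 := by
    intro s hs
    apply eulerUnit_ne_zero N r (halfLinePt (Real.exp s) (Real.exp_pos s))
    apply Complex.ext
    · simpa [hU] using hs
    · simpa using eulerUnit_halfLinePt_im N r (Real.exp s) (Real.exp_pos s)
  have hlim : Tendsto U atTop (𝓝 1) := by
    have h := ((isIntUnitQExp_eulerUnit N r).tendsto_one).comp tendsto_halfLinePt_exp_atImInfty
    have h2 := Complex.continuous_re.continuousAt.tendsto.comp h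
    rw [Complex.one_re] at h2
    exact h2
  have hev : ∀ᶠ s : ℝ in atTop, 1 / 2 < U s := hlim.eventually (eventually_gt_nhds (by norm_num))
  obtain ⟨s₁, hs₁⟩ := (hev.and (eventually_ge_atTop (Real.log y))).exists
  -- the value at `s₀ = log y` is the one we want
  have hpt : halfLinePt (Real.exp (Real.log y)) (Real.exp_pos _) = halfLinePt y hy := by
    apply UpperHalfPlane.ext
    simp [coe_halfLinePt, Real.exp_log hy]
  have hval : U (Real.log y) = (eulerUnit N r (halfLinePt y hy)).re := by
    simp only [hU]
    rw [hpt]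
  rw [← hval]
  by_contra hneg
  push Not at hneg
  have hz0 : 0 ≤ U s₁ := by linarith [hs₁.1]
  have hmem : (0 : ℝ) ∈ Set.Icc (U (Real.log y)) (U s₁) := ⟨hneg, hz0⟩
  obtain ⟨c, _, hc⟩ := intermediate_value_Icc hs₁.2 hUc.continuousOn hmem
  exact hUne c hc

/-! ### The values at `τ₀` -/

/-- **`t(τ₀) = −1/64`** for `t = (η(2τ)η(6τ)/(η(τ)η(3τ)))⁶` and `τ₀ = −1/2 + i√15/6`: on the line
`Re τ = −1/2`, `t = q · (positive)` with `q = −e^{−2πy} < 0`, and `|t(τ₀)| = 1/64`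
(`norm_dombHauptmodul_bswzPoint`). Equivalently `x(τ₀)² = −64 t(τ₀) = 1` for BSWZ's argument
`x = 8i(η(2τ)η(6τ)/(η(τ)η(3τ)))³` ("the argument attains the value 1").
[cite: BorweinEtAl2012, §4 Remark 7] -/
theorem dombHauptmodul_bswzPoint :
    etaQuotient 6 dombHauptmodulExponents bswzPoint = -1 / 64 := by
  have hnorm := norm_dombHauptmodul_bswzPoint
  have hS : (∑ δ ∈ (6 : ℕ).divisors, (δ : ℤ) * dombHauptmodulExponents δ : ℤ) = 24 := by decide
  set y : ℝ := Real.sqrt 15 / 6 with hy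
  have hy0 : 0 < y := by positivity
  have hpt : bswzPoint = halfLinePt y hy0 := bswzPoint_eq_halfLinePt
  -- `t(τ₀) = q · U` with `q = −e^{−2πy}` and `U > 0` real
  have hval : etaQuotient 6 dombHauptmodulExponents bswzPoint =
      -(Real.exp (-2 * π * y) : ℝ) * eulerUnit 6 dombHauptmodulExponents (halfLinePt y hy0) := by
    rw [etaQuotient_eq_cexp_mul_eulerUnit, hS, hpt]
    congr 1
    rw [← qParam_one_halfLinePt y hy0, Function.Periodic.qParam]
    congr 1
    push_cast
    ring
  have hre : 0 < (eulerUnit 6 dombHauptmodulExponents (halfLinePt y hy0)).re := eulerUnit_re_pos _ _ y hy0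
  have him : (eulerUnit 6 dombHauptmodulExponents (halfLinePt y hy0)).im = 0 := eulerUnit_halfLinePt_im _ _ y hy0
  set U := eulerUnit 6 dombHauptmodulExponents (halfLinePt y hy0) with hUdef
  have hU : U = ((U.re : ℝ) : ℂ) := by
    apply Complex.ext <;> simp [him]
  rw [hval] at hnorm ⊢
  rw [hU] at hnorm ⊢
  have hE : 0 < Real.exp (-2 * π * y) := Real.exp_pos _
  rw [← Complex.ofReal_neg, ← Complex.ofReal_mul, Complex.norm_real, Real.norm_eq_abs,
    abs_of_neg (by nlinarith)] at hnorm
  have hgoal : -Real.exp (-2 * π * y) * U.re = -1 / 64 := by linarith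
  exact_mod_cast hgoal

/-- **`Z(τ₀) = 2√(G/75)/π > 0`** for `Z = η(τ)⁴η(3τ)⁴/(η(2τ)²η(6τ)²)` (`Σ δ r_δ = 0`: `Z` itself is a
positive real on the line `Re τ = −1/2`), with `|Z(τ₀)|² = 4G/(75π²)`
(`norm_dombModularForm_bswzPoint_sq`). [cite: BorweinEtAl2012, §4 Remark 7] -/
theorem dombModularForm_bswzPoint :
    etaQuotient 6 dombExponents bswzPoint =
      ((2 * Real.sqrt (Real.Gamma (1 / 15) * Real.Gamma (2 / 15) * Real.Gamma (4 / 15) *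
        Real.Gamma (8 / 15) / (Real.Gamma (7 / 15) * Real.Gamma (11 / 15) * Real.Gamma (13 / 15) *
          Real.Gamma (14 / 15)) / 75) / π : ℝ) : ℂ) := by
  have hsq := norm_dombModularForm_bswzPoint_sq
  set G := Real.Gamma (1 / 15) * Real.Gamma (2 / 15) * Real.Gamma (4 / 15) *
        Real.Gamma (8 / 15) / (Real.Gamma (7 / 15) * Real.Gamma (11 / 15) * Real.Gamma (13 / 15) *
          Real.Gamma (14 / 15)) with hG
  have hGpos : 0 < G := by
    have hΓ : ∀ x : ℝ, 0 < x → 0 < Real.Gamma x := fun x hx => Real.Gamma_pos_of_pos hx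
    have := hΓ (1/15) (by norm_num); have := hΓ (2/15) (by norm_num); have := hΓ (4/15) (by norm_num)
    have := hΓ (8/15) (by norm_num); have := hΓ (7/15) (by norm_num); have := hΓ (11/15) (by norm_num)
    have := hΓ (13/15) (by norm_num); have := hΓ (14/15) (by norm_num)
    positivity
  have hS : (∑ δ ∈ (6 : ℕ).divisors, (δ : ℤ) * dombExponents δ : ℤ) = 0 := by decide
  set y : ℝ := Real.sqrt 15 / 6 with hy
  have hy0 : 0 < y := by positivity
  have hpt : bswzPoint = halfLinePt y hy0 := bswzPoint_eq_halfLinePt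
  have hval : etaQuotient 6 dombExponents bswzPoint = eulerUnit 6 dombExponents (halfLinePt y hy0) := by
    rw [etaQuotient_eq_cexp_mul_eulerUnit, hS, hpt]
    simp
  have hre : 0 < (eulerUnit 6 dombExponents (halfLinePt y hy0)).re := eulerUnit_re_pos _ _ y hy0
  have him : (eulerUnit 6 dombExponents (halfLinePt y hy0)).im = 0 := eulerUnit_halfLinePt_im _ _ y hy0
  set U := eulerUnit 6 dombExponents (halfLinePt y hy0) with hUdef
  have hU : U = ((U.re : ℝ) : ℂ) := by
    apply Complex.ext <;> simp [him]
  rw [hval] at hsq ⊢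
  rw [hU] at hsq ⊢
  rw [Complex.norm_real, Real.norm_eq_abs, abs_of_pos hre] at hsq
  congr 1
  have hπ : 0 < π := Real.pi_pos
  have hR : 0 ≤ 2 * Real.sqrt (G / 75) / π := by positivity
  refine (pow_left_inj₀ hre.le hR two_ne_zero).mp ?_
  rw [hsq, div_pow, mul_pow, Real.sq_sqrt (by positivity)]
  field_simp
  ring

end Literature.NumberTheory.ModularForms

end
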